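import Mathlib
import Summits.KontsevichZagierPeriods.Zeta5Search.BrickLinearForms
import Summits.KontsevichZagierPeriods.Zeta5Search.RVCasoratianNormalForm

/-!
# BrickBallTelescope — Zudilin's creative-telescoping certificate for BALL's kernel `(A,B,ε) = (4,1,1)`:
`(n+1)³R_{n+1}(t) − (2n+1)(17n²+17n+5)R_n(t) + n³R_{n−1}(t) = S_n(t+1) − S_n(t)` and `S_n(t) = O(t^{−2n})`
(cell zeta5-irr)

HONEST FRAMING: systematic search; no irrationality claim unless certified. INSTRUMENT lemma of the ζ(5)
census cell zeta5-irr (HOME `run/shared/lean/pub/zeta5-irr/`). Source: W. Zudilin, *An elementary proof of Apéry's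
theorem*, e-print math.NT/0202159 (2002) [held text `paper:arxiv-math_0202159`], eq. (8) «`R̃_n(t) := n!²(2t+n)(t−1)⋯(t−n)·
(t+n+1)⋯(t+2n)/(t(t+1)⋯(t+n))⁴` … proposed by K. Ball» — this is `2·brickKernel 4 1 1 n t` of the tree — eq. (13) «For
the rational function (8) we obtain Zeilberger's certificate `S̃_n(t) := R̃_n(t)/((2t+n)(t+2n−1)(t+2n)) · (−t⁶ − (8n−1)t⁵ +
(4n²+27n+5)t⁴ + 2n(67n²+71n+15)t³ + (358n⁴+339n³+76n²−7n−3)t² + (384n⁵+396n⁴+97n³−29n²−17n−2)t + n(153n⁵+183n⁴+50n³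
−30n²−22n−4))`» and **Lemma 5** «For each `n = 1,2,…`, there holds the identity `(n+1)³R̃_{n+1}(t) − (2n+1)(17n²+17n+5)R̃_n(t)
+ n³R̃_{n−1}(t) = S̃_n(t+1) − S̃_n(t)`. 'One-line' proof. Divide both sides by `R̃_n(t)` and verify the reduced identity.»
Here everything is divided by `2`: `ballCert n t = S̃_n(t)/2 = R_n(t)·P₆(t)/((2t+n)(t+2n−1)(t+2n))` with `R_n = brickKernel 4 1 1 n`.
The identity was checked in exact rational arithmetic against the tree's normalisation before typing (zi-eng g11 NOTES).
Nothing here is about ζ(5); filing moves no rung. Filed by the engine seat zi-eng (g11); used by `BrickBallApery` (Ball's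
series = Apéry's `b_nζ(3) − a_n`, hence THEOREM 10 at `(4,1)` ⊇ the Apéry-number supercongruences).

## What is PROVED (everything; standard axioms)

* `ballKernel_eq` — `R_n(t) = n!²(t+n/2)·(t−n)_n·(t+n+1)_n/((t)_{n+1})⁴` in Ball–Rivoal Pochhammer notation (`poch`);
* Pochhammer two-step shifts `poch_succ_left_two`, `poch_succ_right_two` (one-step ones are the tree's `RVFlatGauge.poch_succ_left/right`);
* **`ball_telescope`** — Zudilin's Lemma 5 in the tree's normalisation, for every `n ≥ 1` (written `n+1`) and every
  rational `t > 0` (all the poles are at `t ≤ 0`): `(n+2)³R_{n+2}(t) − (2n+3)(17(n+1)²+17(n+1)+5)R_{n+1}(t) + (n+1)³R_n(t)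
  = ballCert (n+1) (t+1) − ballCert (n+1) t`; `ballCert_one` (`S_n(1) = 0`, `n ≥ 1`);
* the DECAY `abs_ballPoly_le`, `ballKernel_le`, `abs_ballCert_le` (`|S_{n+1}(t)| ≤ C_n/t` for `t ≥ n+2`) and
  `tendsto_ballCert` (`S_{n+1}(k+1) → 0` in `ℝ` as `k → ∞`), with the cast lemma `cast_ballCert`.
-/

namespace Summit.KontsevichZagierPeriods.Zeta5Search.BrickBallTelescope

open Finset Nat Filter
open scoped Topology
open Literature.NumberTheory.Transcendental.BallRivoal (poch poch_pos)
open Summit.KontsevichZagierPeriods.Zeta5Search.BrickKernelFrobenius (brickKernel)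
open Summit.KontsevichZagierPeriods.Zeta5Search.BrickLinearForms (poch_sub_natCast poch_add_natCast_succ
  cast_brickKernel)
open Summit.KontsevichZagierPeriods.Zeta5Search.RVFlatGauge (poch_succ_left poch_succ_right)

noncomputable section

/-! ## The certificate -/

section defs

variable {K : Type*} [Field K]

/-- Zudilin's sextic `P₆(t)` of the certificate (13), with the index `n` as a field element `ν`
[Zudilin, math.NT/0202159, eq. (13)]. -/
def ballPoly (ν t : K) : K :=
  -t ^ 6 - (8 * ν - 1) * t ^ 5 + (4 * ν ^ 2 + 27 * ν + 5) * t ^ 4 + 2 * ν * (67 * ν ^ 2 + 71 * ν + 15) * t ^ 3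
    + (358 * ν ^ 4 + 339 * ν ^ 3 + 76 * ν ^ 2 - 7 * ν - 3) * t ^ 2
    + (384 * ν ^ 5 + 396 * ν ^ 4 + 97 * ν ^ 3 - 29 * ν ^ 2 - 17 * ν - 2) * t
    + ν * (153 * ν ^ 5 + 183 * ν ^ 4 + 50 * ν ^ 3 - 30 * ν ^ 2 - 22 * ν - 4)

/-- **Zudilin's certificate, halved**: `S_n(t) := R_n(t)·P₆(t)/((2t+n)(t+2n−1)(t+2n))` (`= S̃_n(t)/2` of (13), since the
tree's `R_n = brickKernel 4 1 1 n = R̃_n/2`). -/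
def ballCert (n : ℕ) (t : K) : K :=
  brickKernel 4 1 1 n t * ballPoly (n : K) t / ((2 * t + n) * (t + 2 * n - 1) * (t + 2 * n))

end defs

/-! ## Pochhammer bookkeeping (`poch a k = ∏_{s<k}(a+s)`, rational) -/

/- One-step shifts `(a)_{k+1} = a·(a+1)_k = (a)_k·(a+k)` are the tree's `RVFlatGauge.poch_succ_left/right`
(`RVCasoratianNormalForm`). -/

/-- `(a)_{k+2} = a(a+1)·(a+2)_k`. -/
theorem poch_succ_left_two (a : ℚ) (k : ℕ) : poch a (k + 2) = a * (a + 1) * poch (a + 2) k := by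
  rw [poch_succ_left, poch_succ_left, add_assoc, one_add_one_eq_two, mul_assoc]

/-- `(a)_{k+2} = (a)_k·(a+k)(a+k+1)`. -/
theorem poch_succ_right_two (a : ℚ) (k : ℕ) : poch a (k + 2) = poch a k * ((a + k) * (a + k + 1)) := by
  rw [poch_succ_right, poch_succ_right, mul_assoc]
  push_cast
  ring

/-- **Ball's kernel in Pochhammer form**: `R_n(t) = n!²·(t + n/2)·(t−n)_n·(t+n+1)_n/((t)_{n+1})⁴`. -/
theorem ballKernel_eq (n : ℕ) (t : ℚ) :
    brickKernel 4 1 1 n t = (n ! : ℚ) ^ 2 * (t + n / 2) * poch (t - n) n * poch (t + n + 1) n / poch t (n + 1) ^ 4 := by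
  rw [poch_sub_natCast, poch_add_natCast_succ]
  unfold brickKernel
  norm_num
  rfl

/-! ## Lemma 5: the telescoping identity -/

/-- **Zudilin's Lemma 5** (tree normalisation; `n ≥ 1` written as `n+1`; rational `t > 0`):
`(n+2)³R_{n+2}(t) − (2n+3)(17(n+1)²+17(n+1)+5)R_{n+1}(t) + (n+1)³R_n(t) = S_{n+1}(t+1) − S_{n+1}(t)`.
Proof: all five rational functions are written on the three Pochhammer atoms `(t−n)_n`, `(t+n+1)_n`, `(t)_{n+1}` of the
smallest index; after clearing the (positive) denominators it is a polynomial identity (`ring`). -/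
theorem ball_telescope (n : ℕ) {t : ℚ} (ht : 0 < t) :
    ((n : ℚ) + 2) ^ 3 * brickKernel 4 1 1 (n + 2) t
        - (2 * ((n : ℚ) + 1) + 1) * (17 * ((n : ℚ) + 1) ^ 2 + 17 * ((n : ℚ) + 1) + 5) * brickKernel 4 1 1 (n + 1) t
        + ((n : ℚ) + 1) ^ 3 * brickKernel 4 1 1 n t =
      ballCert (n + 1) (t + 1) - ballCert (n + 1) t := by
  have hn0 : (0 : ℚ) ≤ n := n.cast_nonneg
  have hD0 : poch t (n + 1) ≠ 0 := (poch_pos ht _).ne'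
  have ht1 : (t + n + 1 : ℚ) ≠ 0 := by positivity
  have ht2 : (t + n + 2 : ℚ) ≠ 0 := by positivity
  -- block 1 (the falling Pochhammer), on the atom `poch (t - n) n`
  have hQ1 : poch (t - ((n + 1 : ℕ) : ℚ)) (n + 1) = (t - n - 1) * poch (t - n) n := by
    rw [show t - ((n + 1 : ℕ) : ℚ) = t - n - 1 by push_cast; ring, poch_succ_left,
      show t - (n : ℚ) - 1 + 1 = t - n by ring]
  have hQ2 : poch (t - ((n + 2 : ℕ) : ℚ)) (n + 2) = (t - n - 2) * (t - n - 1) * poch (t - n) n := by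
    rw [show t - ((n + 2 : ℕ) : ℚ) = t - n - 2 by push_cast; ring, poch_succ_left_two,
      show t - (n : ℚ) - 2 + 1 = t - n - 1 by ring, show t - (n : ℚ) - 2 + 2 = t - n by ring]
  have hQs : poch (t + 1 - ((n + 1 : ℕ) : ℚ)) (n + 1) = poch (t - n) n * t := by
    rw [show t + 1 - ((n + 1 : ℕ) : ℚ) = t - n by push_cast; ring, poch_succ_right,
      show t - (n : ℚ) + (n : ℚ) = t by ring]
  -- block 2 (the rising Pochhammer), on the atom `poch (t + n + 1) n`
  have hB1 : poch (t + ((n + 1 : ℕ) : ℚ) + 1) (n + 1) =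
      poch (t + n + 1) n * ((t + 2 * n + 1) * (t + 2 * n + 2)) / (t + n + 1) := by
    rw [eq_div_iff ht1, show t + ((n + 1 : ℕ) : ℚ) + 1 = t + n + 1 + 1 by push_cast; ring]
    have h := (poch_succ_left (t + n + 1) (n + 1)).symm.trans (poch_succ_right_two (t + n + 1) n)
    linear_combination h
  have hB2 : poch (t + ((n + 2 : ℕ) : ℚ) + 1) (n + 2) = poch (t + n + 1) n * ((t + 2 * n + 1) * (t + 2 * n + 2)) *
      ((t + 2 * n + 3) * (t + 2 * n + 4)) / ((t + n + 1) * (t + n + 2)) := by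
    rw [eq_div_iff (mul_ne_zero ht1 ht2), show t + ((n + 2 : ℕ) : ℚ) + 1 = t + n + 1 + 2 by push_cast; ring]
    have h1 := poch_succ_left_two (t + n + 1) (n + 2)
    have h2 := poch_succ_right_two (t + n + 1) (n + 2)
    rw [poch_succ_right_two (t + n + 1) n] at h2
    have h := h1.symm.trans h2
    push_cast at h
    linear_combination h
  have hBs : poch (t + 1 + ((n + 1 : ℕ) : ℚ) + 1) (n + 1) = poch (t + n + 1) n * ((t + 2 * n + 1) * (t + 2 * n + 2)) *
      (t + 2 * n + 3) / ((t + n + 1) * (t + n + 2)) := by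
    rw [eq_div_iff (mul_ne_zero ht1 ht2), show t + 1 + ((n + 1 : ℕ) : ℚ) + 1 = t + n + 1 + 2 by push_cast; ring]
    have h1 := poch_succ_left_two (t + n + 1) (n + 1)
    have h2 := poch_succ_right_two (t + n + 1) (n + 1)
    rw [poch_succ_right (t + n + 1) n] at h2
    have h := h1.symm.trans h2
    push_cast at h
    linear_combination h
  -- the denominators, on the atom `poch t (n + 1)`
  have hD1 : poch t (n + 1 + 1) = poch t (n + 1) * (t + n + 1) := by
    rw [poch_succ_right]; push_cast; ring
  have hD2 : poch t (n + 2 + 1) = poch t (n + 1) * ((t + n + 1) * (t + n + 2)) := by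
    rw [show n + 2 + 1 = n + 1 + 2 by ring, poch_succ_right_two]; push_cast; ring
  have hDs : poch (t + 1) (n + 1 + 1) = poch t (n + 1) * ((t + n + 1) * (t + n + 2)) / t := by
    rw [eq_div_iff ht.ne']
    have h := (poch_succ_left t (n + 1 + 1)).symm.trans (poch_succ_right_two t (n + 1))
    push_cast at h
    linear_combination h
  -- factorials
  have hf1 : (((n + 1)! : ℕ) : ℚ) = (n + 1) * (n ! : ℚ) := by push_cast [Nat.factorial_succ]; ring
  have hf2 : (((n + 2)! : ℕ) : ℚ) = (n + 1) * (n + 2) * (n ! : ℚ) := by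
    rw [show n + 2 = n + 1 + 1 by ring]; push_cast [Nat.factorial_succ]; ring
  -- rewrite everything on the atoms
  rw [ballCert, ballCert, ballKernel_eq, ballKernel_eq, ballKernel_eq, ballKernel_eq, hQ1, hQ2, hQs, hB1, hB2, hBs,
    hD1, hD2, hDs, hf1, hf2]
  set Q := poch (t - n) n
  set B := poch (t + n + 1) n
  set D := poch t (n + 1)
  push_cast
  have h3 : (2 * t + ((n : ℚ) + 1)) ≠ 0 := by positivity
  have h4 : (t + 2 * ((n : ℚ) + 1) - 1) ≠ 0 := ne_of_gt (by linarith)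
  have h5 : (t + 2 * ((n : ℚ) + 1)) ≠ 0 := by positivity
  have h6 : (2 * (t + 1) + ((n : ℚ) + 1)) ≠ 0 := by positivity
  have h7 : (t + 1 + 2 * ((n : ℚ) + 1) - 1) ≠ 0 := ne_of_gt (by linarith)
  have h8 : (t + 1 + 2 * ((n : ℚ) + 1)) ≠ 0 := by positivity
  have h9 : (t : ℚ) ≠ 0 := ht.ne'
  unfold ballPoly
  field_simp
  ring

/-- `S_n(1) = 0` for `n ≥ 1` (the kernel vanishes at `t = 1`: factor `t − 1`). -/
theorem ballCert_one (n : ℕ) : ballCert (n + 1) (1 : ℚ) = 0 := by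
  have h : brickKernel 4 1 1 (n + 1) (1 : ℚ) = 0 := by
    unfold brickKernel
    have hz : ∏ m ∈ Icc 1 (n + 1), ((1 : ℚ) - m) = 0 :=
      Finset.prod_eq_zero (Finset.mem_Icc.2 ⟨le_rfl, by omega⟩) (by norm_num)
    rw [hz]
    simp
  rw [ballCert, h, zero_mul, zero_div]

/-! ## Decay of the certificate -/

/-- `|P₆(t)| ≤ 2502·(n+1)⁶·t⁶` for `t ≥ 1` (crude coefficient bound). -/
theorem abs_ballPoly_le (n : ℕ) {t : ℚ} (ht : 1 ≤ t) :
    |ballPoly (n : ℚ) t| ≤ 2502 * ((n : ℚ) + 1) ^ 6 * t ^ 6 := by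
  have hn : (0 : ℚ) ≤ n := n.cast_nonneg
  have ht0 : 0 ≤ t := by linarith
  set N : ℚ := (n : ℚ) + 1 with hNdef
  have hN1 : 1 ≤ N := by rw [hNdef]; linarith
  have hnN : (n : ℚ) ≤ N := by rw [hNdef]; linarith
  have t5 : t ^ 5 ≤ t ^ 6 := pow_le_pow_right₀ ht (by norm_num)
  have t4 : t ^ 4 ≤ t ^ 6 := pow_le_pow_right₀ ht (by norm_num)
  have t3 : t ^ 3 ≤ t ^ 6 := pow_le_pow_right₀ ht (by norm_num)
  have t2 : t ^ 2 ≤ t ^ 6 := pow_le_pow_right₀ ht (by norm_num)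
  have t1 : t ≤ t ^ 6 := le_self_pow₀ ht (by norm_num)
  have t0 : 1 ≤ t ^ 6 := one_le_pow₀ ht
  have e2 : N ≤ N ^ 6 := le_self_pow₀ hN1 (by norm_num)
  have e3 : N ^ 2 ≤ N ^ 6 := pow_le_pow_right₀ hN1 (by norm_num)
  have e4 : N ^ 3 ≤ N ^ 6 := pow_le_pow_right₀ hN1 (by norm_num)
  have e5 : N ^ 4 ≤ N ^ 6 := pow_le_pow_right₀ hN1 (by norm_num)
  have e6 : N ^ 5 ≤ N ^ 6 := pow_le_pow_right₀ hN1 (by norm_num)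
  -- termwise bounds
  have c0 : |(-t ^ 6 : ℚ)| ≤ 1 * N ^ 6 * t ^ 6 := by
    rw [abs_neg, abs_of_nonneg (by positivity)]; nlinarith [one_le_pow₀ (n := 6) hN1]
  have c1 : |(8 * (n : ℚ) - 1) * t ^ 5| ≤ 9 * N ^ 6 * t ^ 6 := by
    rw [abs_mul, abs_of_nonneg (by positivity : (0:ℚ) ≤ t ^ 5)]
    have : |8 * (n : ℚ) - 1| ≤ 9 * N := by rw [abs_le]; constructor <;> nlinarith
    calc _ ≤ 9 * N * t ^ 5 := by gcongr
      _ ≤ 9 * N ^ 6 * t ^ 6 := by gcongr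
  have c2 : |(4 * (n : ℚ) ^ 2 + 27 * n + 5) * t ^ 4| ≤ 36 * N ^ 6 * t ^ 6 := by
    rw [abs_mul, abs_of_nonneg (by positivity : (0:ℚ) ≤ t ^ 4), abs_of_nonneg (by positivity)]
    have : 4 * (n : ℚ) ^ 2 + 27 * n + 5 ≤ 36 * N ^ 2 := by nlinarith
    calc _ ≤ 36 * N ^ 2 * t ^ 4 := by gcongr
      _ ≤ 36 * N ^ 6 * t ^ 6 := by gcongr
  have c3 : |2 * (n : ℚ) * (67 * (n : ℚ) ^ 2 + 71 * n + 15) * t ^ 3| ≤ 306 * N ^ 6 * t ^ 6 := by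
    rw [abs_mul, abs_of_nonneg (by positivity : (0:ℚ) ≤ t ^ 3), abs_of_nonneg (by positivity)]
    have : 2 * (n : ℚ) * (67 * (n : ℚ) ^ 2 + 71 * n + 15) ≤ 306 * N ^ 3 := by nlinarith
    calc _ ≤ 306 * N ^ 3 * t ^ 3 := by gcongr
      _ ≤ 306 * N ^ 6 * t ^ 6 := by gcongr
  have c4 : |(358 * (n : ℚ) ^ 4 + 339 * (n : ℚ) ^ 3 + 76 * (n : ℚ) ^ 2 - 7 * n - 3) * t ^ 2| ≤ 783 * N ^ 6 * t ^ 6 := by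
    rw [abs_mul, abs_of_nonneg (by positivity : (0:ℚ) ≤ t ^ 2)]
    have : |358 * (n : ℚ) ^ 4 + 339 * (n : ℚ) ^ 3 + 76 * (n : ℚ) ^ 2 - 7 * n - 3| ≤ 783 * N ^ 4 := by
      rw [abs_le]; constructor <;> nlinarith [pow_nonneg hn 2, pow_nonneg hn 3, pow_nonneg hn 4]
    calc _ ≤ 783 * N ^ 4 * t ^ 2 := by gcongr
      _ ≤ 783 * N ^ 6 * t ^ 6 := by gcongr
  have c5 : |(384 * (n : ℚ) ^ 5 + 396 * (n : ℚ) ^ 4 + 97 * (n : ℚ) ^ 3 - 29 * (n : ℚ) ^ 2 - 17 * n - 2) * t| ≤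
      925 * N ^ 6 * t ^ 6 := by
    rw [abs_mul, abs_of_nonneg ht0]
    have : |384 * (n : ℚ) ^ 5 + 396 * (n : ℚ) ^ 4 + 97 * (n : ℚ) ^ 3 - 29 * (n : ℚ) ^ 2 - 17 * n - 2| ≤ 925 * N ^ 5 := by
      rw [abs_le]; constructor <;> nlinarith [pow_nonneg hn 2, pow_nonneg hn 3, pow_nonneg hn 4, pow_nonneg hn 5]
    calc _ ≤ 925 * N ^ 5 * t := by gcongr
      _ ≤ 925 * N ^ 6 * t ^ 6 := by gcongr
  have c6 : |(n : ℚ) * (153 * (n : ℚ) ^ 5 + 183 * (n : ℚ) ^ 4 + 50 * (n : ℚ) ^ 3 - 30 * (n : ℚ) ^ 2 - 22 * n - 4)| ≤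
      442 * N ^ 6 * t ^ 6 := by
    have : |(n : ℚ) * (153 * (n : ℚ) ^ 5 + 183 * (n : ℚ) ^ 4 + 50 * (n : ℚ) ^ 3 - 30 * (n : ℚ) ^ 2 - 22 * n - 4)| ≤
        442 * N ^ 6 := by
      rw [abs_le]; constructor <;>
        nlinarith [pow_nonneg hn 2, pow_nonneg hn 3, pow_nonneg hn 4, pow_nonneg hn 5, pow_nonneg hn 6]
    calc _ ≤ 442 * N ^ 6 := this
      _ = 442 * N ^ 6 * 1 := (mul_one _).symm
      _ ≤ 442 * N ^ 6 * t ^ 6 := by gcongr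
  have d0 := abs_le.1 c0; have d1 := abs_le.1 c1; have d2 := abs_le.1 c2; have d3 := abs_le.1 c3
  have d4 := abs_le.1 c4; have d5 := abs_le.1 c5; have d6 := abs_le.1 c6
  unfold ballPoly
  rw [abs_le]
  constructor <;> linarith [d0.1, d0.2, d1.1, d1.2, d2.1, d2.2, d3.1, d3.2, d4.1, d4.2, d5.1, d5.2, d6.1, d6.2]

/-- **Decay of Ball's kernel**: for `t ≥ n+1` (beyond the zeros), `0 ≤ R_n(t) ≤ 2·3ⁿ·n!²·t^{−2n−3}`. -/
theorem ballKernel_le (n : ℕ) {t : ℚ} (ht : (n : ℚ) + 1 ≤ t) :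
    0 ≤ brickKernel 4 1 1 n t ∧ brickKernel 4 1 1 n t ≤ 2 * 3 ^ n * (n ! : ℚ) ^ 2 / t ^ (2 * n + 3) := by
  have hn : (0 : ℚ) ≤ n := n.cast_nonneg
  have ht1 : 1 ≤ t := by linarith
  have ht0 : 0 < t := by linarith
  rw [ballKernel_eq]
  have hQ0 : 0 ≤ poch (t - n) n := (poch_pos (by linarith) n).le
  have hQ : poch (t - n) n ≤ t ^ n := by
    rw [poch]
    calc ∏ s ∈ range n, (t - n + (s : ℚ)) ≤ ∏ _s ∈ range n, t :=
          Finset.prod_le_prod (fun s hs => by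
              have := mem_range.1 hs; have : (s : ℚ) + 1 ≤ n := by exact_mod_cast this
              linarith)
            fun s hs => by
              have := mem_range.1 hs; have : (s : ℚ) + 1 ≤ n := by exact_mod_cast this
              linarith
      _ = t ^ n := by rw [Finset.prod_const, Finset.card_range]
  have hB0 : 0 ≤ poch (t + n + 1) n := (poch_pos (by linarith) n).le
  have hB : poch (t + n + 1) n ≤ (3 * t) ^ n := by
    rw [poch]
    calc ∏ s ∈ range n, (t + n + 1 + (s : ℚ)) ≤ ∏ _s ∈ range n, (3 * t) :=
          Finset.prod_le_prod (fun s _ => by positivity) fun s hs => by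
            have := mem_range.1 hs; have : (s : ℚ) + 1 ≤ n := by exact_mod_cast this
            linarith
      _ = (3 * t) ^ n := by rw [Finset.prod_const, Finset.card_range]
  have hD : t ^ (n + 1) ≤ poch t (n + 1) := by
    rw [poch]
    calc t ^ (n + 1) = ∏ _s ∈ range (n + 1), t := by rw [Finset.prod_const, Finset.card_range]
      _ ≤ ∏ s ∈ range (n + 1), (t + (s : ℚ)) :=
          Finset.prod_le_prod (fun s _ => ht0.le) fun s _ => by linarith [(s.cast_nonneg : (0 : ℚ) ≤ s)]
  have hDpos : 0 < poch t (n + 1) := poch_pos ht0 _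
  have hc' : t + n / 2 ≤ 2 * t := by linarith
  refine ⟨by positivity, ?_⟩
  rw [div_le_div_iff₀ (by positivity) (by positivity)]
  calc (n ! : ℚ) ^ 2 * (t + n / 2) * poch (t - n) n * poch (t + n + 1) n * t ^ (2 * n + 3)
      ≤ (n ! : ℚ) ^ 2 * (2 * t) * t ^ n * (3 * t) ^ n * t ^ (2 * n + 3) := by gcongr
    _ = 2 * 3 ^ n * (n ! : ℚ) ^ 2 * (t ^ (n + 1)) ^ 4 := by ring
    _ ≤ 2 * 3 ^ n * (n ! : ℚ) ^ 2 * poch t (n + 1) ^ 4 := by gcongr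

/-- **Decay of the certificate**: for `n ≥ 1` (written `n+1`) and `t ≥ n+2`: `|S_{n+1}(t)| ≤ C/t` with
`C = 2·3^{n+1}·(n+1)!²·2502·(n+2)⁶`. -/
theorem abs_ballCert_le (n : ℕ) {t : ℚ} (ht : (n : ℚ) + 2 ≤ t) :
    |ballCert (n + 1) t| ≤ 2 * 3 ^ (n + 1) * (((n + 1)! : ℕ) : ℚ) ^ 2 * (2502 * ((n : ℚ) + 2) ^ 6) / t := by
  have hn : (0 : ℚ) ≤ n := n.cast_nonneg
  have ht1 : 1 ≤ t := by linarith
  have ht0 : 0 < t := by linarith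
  obtain ⟨hR0, hR⟩ := ballKernel_le (n + 1) (t := t) (by push_cast; linarith)
  have hP := abs_ballPoly_le (n + 1) ht1
  push_cast at hP
  rw [show (n : ℚ) + 1 + 1 = n + 2 by ring] at hP
  have hden0 : 0 < (2 * t + ((n + 1 : ℕ) : ℚ)) * (t + 2 * ((n + 1 : ℕ) : ℚ) - 1) * (t + 2 * ((n + 1 : ℕ) : ℚ)) := by
    push_cast
    exact mul_pos (mul_pos (by positivity) (by linarith)) (by positivity)
  have hden : t ^ 3 ≤ (2 * t + ((n + 1 : ℕ) : ℚ)) * (t + 2 * ((n + 1 : ℕ) : ℚ) - 1) * (t + 2 * ((n + 1 : ℕ) : ℚ)) := by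
    push_cast
    have h1 : t ≤ 2 * t + (n + 1) := by linarith
    have h2 : t ≤ t + 2 * (n + 1) - 1 := by linarith
    have h3 : t ≤ t + 2 * (n + 1) := by linarith
    calc t ^ 3 = t * t * t := by ring
      _ ≤ (2 * t + (n + 1)) * (t + 2 * (n + 1) - 1) * (t + 2 * (n + 1)) :=
          mul_le_mul (mul_le_mul h1 h2 ht0.le (by linarith)) h3 ht0.le (mul_nonneg (by linarith) (by linarith))
  rw [ballCert, abs_div, abs_mul, abs_of_nonneg hR0, abs_of_pos hden0, div_le_div_iff₀ hden0 ht0]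
  push_cast at hR hden hden0 ⊢
  calc brickKernel 4 1 1 (n + 1) t * |ballPoly ((n : ℚ) + 1) t| * t
      ≤ (2 * 3 ^ (n + 1) * (((n + 1)! : ℕ) : ℚ) ^ 2 / t ^ (2 * (n + 1) + 3)) * (2502 * ((n : ℚ) + 2) ^ 6 * t ^ 6) * t := by
        gcongr
    _ = 2 * 3 ^ (n + 1) * (((n + 1)! : ℕ) : ℚ) ^ 2 * (2502 * ((n : ℚ) + 2) ^ 6) * (t ^ 7 / t ^ (2 * n + 5)) := by
        rw [show 2 * (n + 1) + 3 = 2 * n + 5 by ring]; ring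
    _ ≤ 2 * 3 ^ (n + 1) * (((n + 1)! : ℕ) : ℚ) ^ 2 * (2502 * ((n : ℚ) + 2) ^ 6) * t ^ 3 := by
        gcongr
        rw [div_le_iff₀ (by positivity), ← pow_add]
        exact pow_le_pow_right₀ ht1 (by omega)
    _ ≤ _ := by gcongr

/-- Cast: the rational certificate read in `ℝ`. -/
theorem cast_ballCert (n : ℕ) (t : ℚ) : ((ballCert n t : ℚ) : ℝ) = ballCert n (t : ℝ) := by
  unfold ballCert ballPoly
  push_cast [cast_brickKernel]
  rfl

/-- **`S_{n+1}(k+1) → 0`** as `k → ∞` (in `ℝ`). -/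
theorem tendsto_ballCert (n : ℕ) :
    Tendsto (fun k : ℕ => ((ballCert (n + 1) ((k : ℚ) + 1) : ℚ) : ℝ)) atTop (𝓝 0) := by
  set C : ℚ := 2 * 3 ^ (n + 1) * (((n + 1)! : ℕ) : ℚ) ^ 2 * (2502 * ((n : ℚ) + 2) ^ 6) with hC
  have hlim : Tendsto (fun k : ℕ => ((C : ℚ) : ℝ) / ((k : ℝ) + 1)) atTop (𝓝 0) := by
    have h := (tendsto_add_atTop_iff_nat 1).2 (tendsto_const_div_atTop_nhds_zero_nat ((C : ℚ) : ℝ))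
    refine h.congr fun k => ?_
    push_cast
    rfl
  refine squeeze_zero_norm' ?_ hlim
  rw [Filter.eventually_atTop]
  refine ⟨n + 1, fun k hk => ?_⟩
  have hk' : (n : ℚ) + 1 ≤ k := by exact_mod_cast hk
  have hb := abs_ballCert_le n (t := (k : ℚ) + 1) (by linarith)
  rw [Real.norm_eq_abs, ← Rat.cast_abs, show ((C : ℚ) : ℝ) / ((k : ℝ) + 1) = ((C / ((k : ℚ) + 1) : ℚ) : ℝ) by
    rw [Rat.cast_div, Rat.cast_add, Rat.cast_natCast, Rat.cast_one]]
  exact Rat.cast_le.2 hb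

end

end Summit.KontsevichZagierPeriods.Zeta5Search.BrickBallTelescope
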